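import Summits.MatrixMultiplication.MatrixMultiplication.Theses.AsymptoticRankCW
import Literature.Computability.AlgebraicComplexity.StrictAsymptoticSumInequality
import Literature.Computability.AlgebraicComplexity.BorderRankCWDischarge

/-!
# MatrixMultiplication / AsymptoticRankCW — support `BStrictSubmult`
(stmt-MatrixMultiplication-0590)

Support item of route AsymptoticRankCW, exact route decl:

  `∃ k : ℕ, 0 < k ∧ R(T_cw,2^{⊠k}) < 4 ^ k`

(the `k`-th Kronecker power of the small Coppersmith–Winograd tensor `T_cw,2` written inline on
`Fin k → Fin 3`; it is definitionally `kroneckerPow (cwTensor ℂ 2) k`).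

## Proof

The statement is the rank form of `R̃(T_cw,2) < 4 = bR(T_cw,2)` ("`ω` is an infimum, not a
minimum" for a single tensor: Alman–Li 2026 = arXiv:2605.21738, Cor. 6.1 "if `bR(T) ≤ r` and
`r > n` then `R̃(T) < r`", Cor. 7.1 for `cw_2`; Strassen 1988), assembled from tree results:

* `lt_of_algBorderRank_le_of_card_lt` — for a universal spectral point `F` (CVZ 2023, §1.2) and a
  tensor `t ∈ K^ι ⊗ K^κ ⊗ K^μ` with `bR(t) ≤ r`, `|ι| < r` and `|κ| + |μ| < r`: `F(t) < r`.
  Otherwise `F(t) = bR(t) = r`; the explicit one-slice speedup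
  `t ⊕ ⟨1,r,1⟩ ⊴ ⟨r⟩ ⊕ ⟨1,|κ|+|μ|,1⟩` (`algDegeneratesTo_oneSliceSpeedup`, Alman–Li Thm. 6.1) and
  monotonicity of `F` under degeneration give `g(r) ≤ g(|κ|+|μ|)` for the multiplicative monotone
  one-slice values `g(n) = F(⟨1,n,1⟩)`, whence `g ≡ 1` (`oneSliceValue_eq_one`), and then
  `t ≤ ⟨|ι|⟩ ⊗ oneSlice(μ)` (`tensorRestrictsTo_unitTensor_kronecker_oneSlice`) gives
  `F(t) ≤ |ι| < r`, absurd.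
* `asymptoticRank_cwTensor_two_lt_four` — applied to `t = T_cw,2^{⊠3} ∈ (ℂ^27)^{⊗3}`, `r = 64`
  (`bR ≤ 4^3`, `27 < 64`, `54 < 64`): `F(T_cw,2)^3 = F(T^{⊠3}) < 64` for every universal `F`,
  so `R̃(T_cw,2) = max_F F(T_cw,2) < 4` (Strassen duality `strassen_duality_asymptoticRank_holds`).
* `bStrictSubmult_proof` — `R̃ = inf_k R(T^{⊠k})^{1/k} < 4` yields `k` with `R(T^{⊠k}) < 4^k`.

No explicit `k` is produced (the first open case in print is `k = 3`, CGLV 2022 Question 3;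
`k ≤ 2` is excluded by `bR(T_cw,2^{⊠2}) = 16`, Conner–Huang–Landsberg 2020).

References: J. Alman, B. Li, *Asymptotic Rank Speedup Theorems, Revisited*, arXiv:2605.21738
(2026), Thm. 6.1, Cor. 6.1, Cor. 7.1 [AlmanLi2026]; V. Strassen, J. reine angew. Math. 384 (1988)
[Strassen1988]; M. Christandl, P. Vrana, J. Zuiddam, JAMS 36 (2023), §1.2, Prop. 1.6
[ChristandlVranaZuiddam2023].
-/

noncomputable section

open scoped BigOperators

namespace Summit.MatrixMultiplication.MatrixMultiplication.Theorems

open Literature.Computability.AlgebraicComplexity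

universe u

/-! ## Two small tensor facts -/

/-- **`t ≤ ⟨n⟩ ⊗ oneSlice(μ)`** for every `t ∈ K^ι ⊗ K^κ ⊗ K^μ` with `ι ≃ Fin n`: write
`t = ∑_{a} e_a ⊗ M_a` and factor each slice `M_a ∈ K^κ ⊗ K^μ` through the identity matrix on `μ`
(first leg `e_{(a,⋆)} ↦ e_a`, second leg `e_{(a,c)} ↦ ∑_b t_{a b c} e_b`, third leg
`e_{(a,c)} ↦ e_c`). [folklore] -/
theorem tensorRestrictsTo_unitTensor_kronecker_oneSlice {K : Type u} [CommSemiring K]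
    {ι κ μ : Type*} [Fintype ι] [Fintype κ] [Fintype μ] [DecidableEq μ] {n : ℕ}
    (t : ι → κ → μ → K) (e : ι ≃ Fin n) :
    TensorRestrictsTo (kroneckerTensor (unitTensor K n) (oneSliceTensor K μ)) t := by
  classical
  refine ⟨fun a' a => if a.1 = e a' then 1 else 0, fun b' b => t (e.symm b.1) b' b.2,
    fun c' c => if c.2 = c' then 1 else 0, fun a' b' c' => ?_⟩
  rw [Finset.sum_eq_single (e a', ()) (fun a _ ha => ?_) (by simp),
    Finset.sum_eq_single (e a', c') (fun b _ hb => ?_) (by simp),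
    Finset.sum_eq_single (e a', c') (fun c _ hc => ?_) (by simp)]
  · simp
  · -- `c ≠ (e a', c')`
    simp only [kroneckerTensor_apply, unitTensor_apply, oneSliceTensor_apply, true_and]
    by_cases h1 : e a' = c.1
    · have h2 : c.2 ≠ c' := fun h2 => hc (Prod.ext h1.symm h2)
      simp [h2]
    · simp [h1]
  · -- `b ≠ (e a', c')`: every term of the inner sum vanishes
    refine Finset.sum_eq_zero fun c _ => ?_
    simp only [kroneckerTensor_apply, unitTensor_apply, oneSliceTensor_apply]
    by_cases h1 : e a' = b.1
    · have h2 : b.2 ≠ c' := fun h2 => hb (Prod.ext h1.symm h2)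
      by_cases h3 : c.2 = c'
      · have h4 : b.2 ≠ c.2 := fun h4 => h2 (h4.trans h3)
        simp [h4]
      · simp [h3]
    · simp [h1]
  · -- `a ≠ (e a', ())`: the first-leg coefficient vanishes
    have h1 : a.1 ≠ e a' := fun h1 => ha (Prod.ext h1 (Subsingleton.elim _ _))
    simp [h1]

/-- A tensor with an empty second index type has rank `0`. [folklore] -/
theorem tensorRank_eq_zero_of_isEmpty {K : Type u} [CommSemiring K] {ι κ μ : Type*}
    [Fintype ι] [Fintype κ] [Fintype μ] [IsEmpty κ] (t : ι → κ → μ → K) : tensorRank t = 0 := by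
  refine Nat.le_zero.1 (tensorRank_le_of_eq_sum (r := 0) (fun _ _ => 0) (fun _ _ => 0)
    (fun _ _ => 0) ?_)
  funext a b c
  exact isEmptyElim b

/-! ## Spectral points below a non-tight border-rank bound (Alman–Li 2026, Cor. 6.1) -/

/-- A universal spectral point takes the value `n` at the unit tensor `⟨n⟩`.
[cite: ChristandlVranaZuiddam2023, §1.2] -/
theorem spectralPoint_unitTensor {K : Type u} [CommSemiring K] {F : SpectralMap K}
    (hF : IsUniversalSpectralPoint K F) (n : ℕ) : F (unitTensor K n) = n := by
  rw [← TensorClass.evalRingHom_mk hF, ← TensorClass.natCast_eq_mk, map_natCast]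

/-- One-slice values of a universal spectral point are at most `1` once they collapse on positive
integers (`g(0) = F(0) = 0`). [folklore] -/
theorem oneSliceValue_le_one_of_collapse {K : Type u} [Field K] {F : SpectralMap K}
    (hF : IsUniversalSpectralPoint K F) (hg : ∀ n, 1 ≤ n → oneSliceValue F n = 1) (n : ℕ) :
    oneSliceValue F n ≤ 1 := by
  rcases Nat.eq_zero_or_pos n with rfl | hn
  · exact (hF.oneSliceValue_le 0).trans (by norm_num)
  · exact (hg n hn).le

/-- **Spectral points are strictly below a non-tight border-rank bound** (Alman–Li 2026, Cor. 6.1 /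
Thm. 6.1 via the explicit one-slice speedup, weak form `s = |κ| + |μ|`; Strassen 1988): if
`bR(t) ≤ r`, `|ι| < r` and `|κ| + |μ| < r` for `t ∈ K^ι ⊗ K^κ ⊗ K^μ` over a field, then `F(t) < r`
for every universal spectral point `F`. [cite: AlmanLi2026, Cor. 6.1] -/
theorem lt_of_algBorderRank_le_of_card_lt {K : Type u} [Field K] {F : SpectralMap K}
    (hF : IsUniversalSpectralPoint K F) {ι κ μ : Type} [Fintype ι] [Fintype κ] [Fintype μ]
    [DecidableEq ι] [DecidableEq κ] [DecidableEq μ] (t : ι → κ → μ → K) {r : ℕ}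
    (hbR : algBorderRank t ≤ r) (hι : Fintype.card ι < r)
    (hκμ : Fintype.card κ + Fintype.card μ < r) : F t < r := by
  by_contra hnot
  have hFt : F t = r := le_antisymm (hF.le_of_algBorderRank_le t hbR) (not_lt.1 hnot)
  -- `bR(t) = r`
  have hbReq : algBorderRank t = r := by
    refine le_antisymm hbR ?_
    have h : F t ≤ (algBorderRank t : ℝ) := hF.le_of_algBorderRank_le t le_rfl
    rw [hFt] at h
    exact_mod_cast h
  -- the one-slice speedup `t ⊕ ⟨1,r,1⟩ ⊴ ⟨r⟩ ⊕ ⟨1,|κ|+|μ|,1⟩`, evaluated at `F`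
  have hmono := hF.mono_of_algDegeneratesTo (algDegeneratesTo_oneSliceSpeedup (K := K) t)
  rw [hF.map_directSum, hF.map_directSum, spectralPoint_unitTensor hF, hbReq, hFt,
    hF.oneSlice_congr (Fintype.equivFin (κ ⊕ μ)).symm, Fintype.card_sum] at hmono
  have hg_le : oneSliceValue F r ≤ oneSliceValue F (Fintype.card κ + Fintype.card μ) := by
    rw [oneSliceValue_def, oneSliceValue_def]
    linarith
  rcases Nat.eq_zero_or_pos (Fintype.card κ + Fintype.card μ) with h0 | hpos
  · -- degenerate format: `κ = ∅`, so `R(t) = 0` and `F(t) = 0 < r`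
    haveI : IsEmpty κ := Fintype.card_eq_zero_iff.1 (by omega)
    have h1 : F t ≤ (tensorRank t : ℝ) := hF.le_tensorRank t
    rw [tensorRank_eq_zero_of_isEmpty t, hFt] at h1
    have h2 : (r : ℝ) ≤ 0 := by exact_mod_cast h1
    have h3 : (0 : ℝ) < r := by exact_mod_cast (Nat.zero_le _).trans_lt hι
    linarith
  · -- `g ≡ 1`, hence `F(t) ≤ |ι| · g(|μ|) ≤ |ι| < r`
    have hg : ∀ n, 1 ≤ n → oneSliceValue F n = 1 := fun n hn =>
      hF.oneSliceValue_eq_one hpos hκμ hg_le hn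
    have hle : F t ≤ Fintype.card ι := by
      calc F t ≤ F (kroneckerTensor (unitTensor K (Fintype.card ι)) (oneSliceTensor K μ)) :=
            hF.mono _ _ (tensorRestrictsTo_unitTensor_kronecker_oneSlice t (Fintype.equivFin ι))
        _ = Fintype.card ι * oneSliceValue F (Fintype.card μ) := by
            rw [hF.map_kronecker, spectralPoint_unitTensor hF,
              hF.oneSlice_congr (Fintype.equivFin μ).symm, oneSliceValue_def]
        _ ≤ Fintype.card ι * 1 :=
            mul_le_mul_of_nonneg_left (oneSliceValue_le_one_of_collapse hF hg _) (Nat.cast_nonneg _)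
        _ = Fintype.card ι := mul_one _
    have h3 : ((Fintype.card ι : ℕ) : ℝ) < r := by exact_mod_cast hι
    linarith

/-! ## The small Coppersmith–Winograd tensor -/

/-- **`R̃(T_cw,2) < 4`** (Alman–Li 2026, Cor. 7.1 gives even `< 3.931`): every universal spectral
point has `F(T_cw,2)^3 = F(T_cw,2^{⊠3}) < 64`, because `bR(T_cw,2^{⊠3}) ≤ 4^3 = 64` while the cube
lives in `(ℂ^27)^{⊗3}` with `27 < 64` and `27 + 27 < 64`. [cite: AlmanLi2026, Cor. 7.1] -/
theorem asymptoticRank_cwTensor_two_lt_four : asymptoticRank (cwTensor ℂ 2) < 4 := by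
  obtain ⟨F, hF, hFt⟩ := (strassen_duality_asymptoticRank_holds ℂ (cwTensor ℂ 2)).2
  rw [← hFt]
  have hbR : algBorderRank (kroneckerPow (cwTensor ℂ 2) 3) ≤ 64 :=
    (algBorderRank_kroneckerPow_le _ 3).trans
      (Nat.pow_le_pow_left (algBorderRank_cwTensor_le ℂ 2) 3)
  have h3 : F (kroneckerPow (cwTensor ℂ 2) 3) < (64 : ℕ) :=
    lt_of_algBorderRank_le_of_card_lt hF _ hbR (by simp) (by simp)
  rw [hF.map_kroneckerPow] at h3
  have h0 : 0 ≤ F (cwTensor ℂ 2) := hF.nonneg _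
  by_contra hnot
  have h4 : (4 : ℝ) ^ 3 ≤ F (cwTensor ℂ 2) ^ 3 := pow_le_pow_left₀ (by norm_num) (not_lt.1 hnot) 3
  push_cast at h3
  linarith

/-- **Support item `BStrictSubmult` of route AsymptoticRankCW** (stmt-MatrixMultiplication-0590),
exact route decl: some Kronecker power of the small Coppersmith–Winograd tensor has strictly
submultiplicative rank, `∃ k ≥ 1, R(T_cw,2^{⊠k}) < 4^k` — from `R̃(T_cw,2) < 4`
(`asymptoticRank_cwTensor_two_lt_four`) and `R̃(t) = inf_k R(t^{⊠k})^{1/k}`.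
[cite: AlmanLi2026, Cor. 7.1] -/
theorem bStrictSubmult_proof :
    Summit.MatrixMultiplication.MatrixMultiplication.Theses.AsymptoticRankCW.BStrictSubmult := by
  unfold Summit.MatrixMultiplication.MatrixMultiplication.Theses.AsymptoticRankCW.BStrictSubmult
  have h := asymptoticRank_cwTensor_two_lt_four
  unfold asymptoticRank at h
  obtain ⟨N, hN⟩ := exists_lt_of_ciInf_lt h
  refine ⟨N + 1, Nat.succ_pos N, ?_⟩
  have h0 : (0 : ℝ) ≤ tensorRank (kroneckerPow (cwTensor ℂ 2) (N + 1)) := Nat.cast_nonneg _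
  have hRM : (tensorRank (kroneckerPow (cwTensor ℂ 2) (N + 1)) : ℝ) < 4 ^ (N + 1) := by
    have := pow_lt_pow_left₀ hN (Real.rpow_nonneg h0 _) (Nat.succ_ne_zero N)
    rwa [show ((N : ℝ) + 1)⁻¹ = ((N + 1 : ℕ) : ℝ)⁻¹ by push_cast; ring,
      Real.rpow_inv_natCast_pow h0 (Nat.succ_ne_zero N)] at this
  have key : tensorRank (kroneckerPow (cwTensor ℂ 2) (N + 1)) < 4 ^ (N + 1) := by
    exact_mod_cast hRM
  -- the route's inline tensor is definitionally `kroneckerPow (cwTensor ℂ 2) (N + 1)`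
  exact key

end Summit.MatrixMultiplication.MatrixMultiplication.Theorems

end
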